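import Summits.QuantumFields.BalabanUV.Beta.GAN24.ZeroModeReflectionParity
import Summits.QuantumFields.BalabanUV.Beta.SpineRecursivePureLaws
import Summits.QuantumFields.BalabanUV.Beta.SpineRecursiveInductive
import Summits.QuantumFields.BalabanUV.Beta.BorderedHessianSymmetry
import Summits.QuantumFields.BalabanUV.Beta.BorderedHessianKernelAction
import Summits.QuantumFields.BalabanUV.Beta.GAN24.ValueHessianLinearGauge
import Summits.QuantumFields.BalabanUV.Beta.GAN24.KernelLegCharges

/-!
# `BalabanUV.Beta.GAN24.CombCubicCellChargeZero` — binder row G-an2-4 ∕ (CONV-C), W-slot, row (C) at levels ≥ 1, THE PARITY ROUTE MADE SPECIFIC (first half):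
# **THE CUBIC CELL CHARGE OF THE COMB TOWER's PURE FIELD TABLE `SpureRecAt j` VANISHES — EVERY LEVEL `j`, EVERY THREE-INDEX PATTERN, AT THE PIN,
# WITH NO LETTER FROM ANYBODY** (road-P2 chair of row G-an2-4, unit `b2b-balaban-gan24-p2` gen 48, crux team (2); READING R-2 (2)(b) of gen 47 made a theorem)

NOT IN PRINT; OUR BOOKKEEPING ([folklore] re-indexing + two Ward zeros BY NAME over an2's PROVED cubic reflection law; 0 `def`, 0 cited facts, 0 `def … : Prop`,
0 sorry).  HONEST FRAMING (cell contract, verbatim): «discharging `BetaPertH` makes Bałaban's UV stability UNCONDITIONAL — a real constructive-QFT result; it is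
NOT the continuum limit and NOT the Clay problem.»  HONEST DEPENDENCY (verbatim): «continuum YM on T⁴ ⇐ BetaPertH ∧ nine spine estimates (0/9 proved); BetaPertH ⇐
(D1) ∧ (D4) ∧ CAP+tail; G-an2-4 gates asym, D1 and NE2/3/4.»

WHAT (`d + 1 = 4`, odd `Lc`, centred root `ρ_c = toSite (ctrOff 4 Lc)`, the pin `(cE, cVH) = (Lc⁴, −Lc⁸∕2)`, ANY `cΛ`; `S_j := SpureRecAt 3 Lc ρ_c Lc⁴ (−Lc⁸∕2) cΛ j`,
`𝕄_j := bhKStepAt 3 ρ_c Lc j`, `γ_j := (−Lc⁸∕2)·wVH j ∕ (stepScale j · Lc⁴)`):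
* §1 **THE SANDWICH KERNEL's ff BLOCK HAS ZERO CONSTANT MODES ON BOTH SIDES, EVERY LEVEL** — `tsum_bhKStepAt_inl_inl_row_eq_zero` ∕ `…_col_eq_zero` (generic `d`, any root):
  level `j+1` = `wVH • E2 (j+1)` (`bhKStepAt_succ_inl_inl`) and leaf-06's `ValueHessianLinearGauge.tsum_E2_mul_const_eq_zero ∕ tsum_const_mul_E2_eq_zero`; level `0` =
  the `d*d` window (`bhKAt_inl_inl`, `tsum_bhK_inl_inl`, `curv_cst`, and the matrix symmetry `curvAdj_curv_delta1_symm` for the columns); rows∕columns summable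
  (`spr_bhKStepAt`).
* §2 **THE (Sr-conj) LAW OF `S_j` AT THE PIN, ONE DISPLAY FOR EVERY LEVEL** — `SpureRecAt_bref_pin`: `S_j κ (bref α κ u) = ε_κ^α • refK (Φ Lc α) (S_j κ u + conjV 𝕄_j (γ_j • diagK
  (ctGen 3 α Lc κ u)))` — an2's PROVED `SpineRecursivePureLaws.pureZero_bref ∕ pureSucc_bref` (gen 17) with the locks supplied by `SpineRecursiveInductive.locks_of_pin ∕
  pin_of_bcj` exactly as `…_inductive_bcj` does.  (g47's WANTED W-an2-2 is THIS theorem — already in the tree in two displays; here in one.)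
* §3 **`cubicCellCharge_SpureRecAt_eq_zero (hLc : Odd Lc) (cΛ) (j) (κ′ κ₁ κ₂) : Σ_{r ∈ box 4 Lc} Σ'_x Σ'_z S_j κ′ (toSite r) x z (inl κ₁) (inl κ₂) = 0`** — my g47 generic
  `ZeroModeReflectionParity.cubicCharge_eq_zero_of_refl_conjV` (a three-index pattern ALWAYS has an axis of odd multiplicity; along it the law of §2 flips the sign of the
  cell charge while its delta-leg contact adds nothing, §1) fed with §1–§2, `SpureRecAt_translate`, `locStencil_SpureRecAt` (summabilities via leaf-06's
  `KernelLegCharges.summable_prod_of_biLoc`) and the delta field leg `ctGen_inl`.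
WHY (located, zero weight): these cubic cell charges are what the `conjW₁` half of the CONTACT DEFECT of an2's quartic reflection law
(`SpineRecursiveT2All.T2RecAt_bref_all_of_letters`) produces after the bond-slot sums (g47 `ZeroModeReflectionParityWords.tsum_tsum_conjW₁_diagK_eq` +
`sum_box_tsum_tsum_recentre`); with them zero (here) and the `conjW₂` half a constant mode of `𝕄_j` again (§1), the defect carries NO ff charge — the companion file
`CombQuarticContactChargeZero` — and the odd-multiplicity half of (C)_{≥1} (216 of 256 patterns at `d = 3`) rests on EXACTLY ONE input: the quartic TABLE-level law at the
literal (WANTED W-an2-1).  Discharges NOTHING of (C)_{≥1} ∕ (Q-L) ∕ (H1♮) by itself; asserts NOTHING about the quartic table; (β) of record untouched; NEVER «G-an2-4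
closed» as (CONV-C); NOT D1, NOT `BetaPertH`, NOT continuum, NOT Clay.  2026-08-23; no existing file touched.
-/

noncomputable section

open Finset
open scoped BigOperators
open Literature.MathematicalPhysics.QuantumFieldTheory
open Literature.MathematicalPhysics.QuantumFieldTheory.Balaban1983to89
open Literature.MathematicalPhysics.QuantumFieldTheory.Balaban1983to89.Beta
open ExpKernelCalculus (MKer shiftK BiLoc Decays)
open OneStepResolventKernel (Fib LocStencil)
open AffineAveraging (box toSite curv curvAdj)
open AffineReproduction (cst curv_cst curvAdj_zero)
open AveragingContoursRooted (ctrOff ctrOff_mem_box)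
open PolarizationSign (reflSign)
open KernelReflection (refK)
open ResolventReflection (bref Φ)
open BalabanStepJetsSucc (E2 wE wVH)
open AxialDressing (summable_row_of_decays summable_col_of_decays)
open Summit.QuantumFields.BalabanUV.Beta.TameKernelCalculus (Spr)
open Summit.QuantumFields.BalabanUV.Beta.ChartConjugation (conjV)
open Summit.QuantumFields.BalabanUV.Beta.BorderedHessian (diagK ctGen ctGen_inl bhK bhKAt bhKAt_inl_inl bhKStepAt bhKStepAt_zero bhKStepAt_succ_inl_inl
  stepScale spr_bhKStepAt tsum_bhK_inl_inl bhK_inl_inl_eq fcol curvAdj_curv_delta1_symm)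
open Summit.QuantumFields.BalabanUV.Beta.VertexReflectionContact (smul_diagK)
open Summit.QuantumFields.BalabanUV.Beta.SpineRooted (SpureRecAt SpureRecAt_zero_level SpureRecAt_succ SpureRecAt_translate locStencil_SpureRecAt
  pureZero_bref pureSucc_bref locks_of_pin pin_of_bcj)
open Summit.QuantumFields.BalabanUV.Beta.GAN24.ValueHessianLinearGauge (tsum_E2_mul_const_eq_zero tsum_const_mul_E2_eq_zero)
open Summit.QuantumFields.BalabanUV.Beta.GAN24.KernelLegCharges (summable_prod_of_biLoc summable_right_of_biLoc)
open Summit.QuantumFields.BalabanUV.Beta.GAN24.ZeroModeReflectionParity (cubicCharge_eq_zero_of_refl_conjV)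

namespace Summit.QuantumFields.BalabanUV.Beta.GAN24.CombCubicCellChargeZero

/-! ## §1 The sandwich kernel's ff block: zero constant modes, summable rows and columns (generic `d`, any root, every level) -/

section Sandwich

variable {d : ℕ} {Lc : ℕ} [NeZero Lc]

/-- [folklore] **ROW CONSTANT MODES OF `bhKStepAt j`'s ff BLOCK VANISH**: level `0` the `d*d` window kills the constant 1-form (`curv_cst`); level `j+1` it is
`wVH • E2 (j+1)` and the value Hessian kills constants (leaf-06's `tsum_E2_mul_const_eq_zero`). -/
theorem tsum_bhKStepAt_inl_inl_row_eq_zero (ρ : Fin (d + 1) → ℤ) :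
    ∀ (j : ℕ) (x : Fin (d + 1) → ℤ) (a b : Fin (d + 1)), ∑' z, bhKStepAt d ρ Lc j x z (Sum.inl a) (Sum.inl b) = 0
  | 0, x, a, b => by
    classical
    have h := tsum_bhK_inl_inl (N := Lc) (fun _ _ f _ => if f = (Sum.inl b : Fib d) then (1 : ℝ) else 0) x x a (Sum.inl b)
    have hin : ∀ y, ∑ l : Fin (d + 1), bhK Lc x y (Sum.inl a) (Sum.inl l) * (if (Sum.inl l : Fib d) = Sum.inl b then (1 : ℝ) else 0)
        = bhK Lc x y (Sum.inl a) (Sum.inl b) := by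
      intro y
      simp only [Sum.inl.injEq, mul_ite, mul_one, mul_zero, Finset.sum_ite_eq', Finset.mem_univ, if_true]
    simp_rw [hin] at h
    have hc : fcol (fun _ _ f _ => if f = (Sum.inl b : Fib d) then (1 : ℝ) else 0) x (Sum.inl b) = cst fun l => if l = b then (1 : ℝ) else 0 := by
      funext l y
      simp only [fcol, cst, Sum.inl.injEq]
    rw [hc, curv_cst, curvAdj_zero] at h
    simpa only [bhKStepAt_zero, bhKAt_inl_inl, Pi.zero_apply] using h
  | j + 1, x, a, b => by
    classical
    have h := tsum_E2_mul_const_eq_zero (d := d) (Lc := Lc) (j + 1) a x (fun l => if l = b then (1 : ℝ) else 0)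
    have hin : ∀ y, ∑ l : Fin (d + 1), E2 d Lc (j + 1) x y (Sum.inl a) (Sum.inl l) * (if l = b then (1 : ℝ) else 0) = E2 d Lc (j + 1) x y (Sum.inl a) (Sum.inl b) := by
      intro y
      simp only [mul_ite, mul_one, mul_zero, Finset.sum_ite_eq', Finset.mem_univ, if_true]
    simp_rw [hin] at h
    simp_rw [bhKStepAt_succ_inl_inl]
    rw [tsum_mul_left, h, mul_zero]

/-- [folklore] **COLUMN CONSTANT MODES VANISH TOO**: level `0` by the matrix symmetry of the `d*d` window (`curvAdj_curv_delta1_symm`), level `j+1` by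
`tsum_const_mul_E2_eq_zero`. -/
theorem tsum_bhKStepAt_inl_inl_col_eq_zero (ρ : Fin (d + 1) → ℤ) :
    ∀ (j : ℕ) (z : Fin (d + 1) → ℤ) (a b : Fin (d + 1)), ∑' x, bhKStepAt d ρ Lc j x z (Sum.inl a) (Sum.inl b) = 0
  | 0, z, a, b => by
    have hsym : ∀ x, bhKStepAt d ρ Lc 0 x z (Sum.inl a) (Sum.inl b) = bhKStepAt d ρ Lc 0 z x (Sum.inl b) (Sum.inl a) := by
      intro x
      simp only [bhKStepAt_zero, bhKAt_inl_inl, bhK_inl_inl_eq]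
      exact curvAdj_curv_delta1_symm _ _ _ _
    simp_rw [hsym]
    exact tsum_bhKStepAt_inl_inl_row_eq_zero ρ 0 z b a
  | j + 1, z, a, b => by
    classical
    have h := tsum_const_mul_E2_eq_zero (d := d) (Lc := Lc) (j + 1) b z (fun κ => if κ = a then (1 : ℝ) else 0)
    have hin : ∀ x, ∑ κ : Fin (d + 1), (if κ = a then (1 : ℝ) else 0) * E2 d Lc (j + 1) x z (Sum.inl κ) (Sum.inl b) = E2 d Lc (j + 1) x z (Sum.inl a) (Sum.inl b) := by
      intro x
      simp only [ite_mul, one_mul, zero_mul, Finset.sum_ite_eq', Finset.mem_univ, if_true]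
    simp_rw [hin] at h
    simp_rw [bhKStepAt_succ_inl_inl]
    rw [tsum_mul_left, h, mul_zero]

/-- [folklore] Rows of `bhKStepAt j` are summable (in-block root; `spr_bhKStepAt`). -/
theorem summable_bhKStepAt_row {r : Fin (d + 1) → ℕ} (hr : r ∈ box (d + 1) Lc) (j : ℕ) (x : Fin (d + 1) → ℤ) (a b : Fib d) :
    Summable fun z => bhKStepAt d (toSite r) Lc j x z a b := by
  obtain ⟨C, δ, hδ, hD⟩ := spr_bhKStepAt (d := d) (Lc := Lc) hr j
  exact summable_row_of_decays hD hδ x a b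

/-- [folklore] Columns of `bhKStepAt j` are summable. -/
theorem summable_bhKStepAt_col {r : Fin (d + 1) → ℕ} (hr : r ∈ box (d + 1) Lc) (j : ℕ) (z : Fin (d + 1) → ℤ) (a b : Fib d) :
    Summable fun x => bhKStepAt d (toSite r) Lc j x z a b := by
  obtain ⟨C, δ, hδ, hD⟩ := spr_bhKStepAt (d := d) (Lc := Lc) hr j
  exact summable_col_of_decays hD hδ z a b

end Sandwich

/-! ## §2 The (Sr-conj) law of the pure field table at the pin — one display for every level -/

section Law

variable {Lc : ℕ} [NeZero Lc]

omit [NeZero Lc] in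
/-- [folklore] The pin identity `2·cVH = −cE·Lc⁴` at `(cE, cVH) = (Lc⁴, −Lc⁸∕2)`. -/
theorem two_mul_cVH_pin : 2 * (-((Lc : ℝ) ^ 8 / 2)) = -((Lc : ℝ) ^ 4 * (Lc : ℝ) ^ 4) := by ring

/-- [folklore] The units lock of `SpineRecursivePureLaws` at the pin (`locks_of_pin` ∘ `pin_of_bcj`, as in `…_inductive_bcj`). -/
theorem locks_pin (j : ℕ) :
    (Lc : ℝ) ^ 4 * wE 3 Lc (j + 1) *
        ((-((Lc : ℝ) ^ 8 / 2)) * wVH 3 Lc j / (stepScale 3 Lc j * (Lc : ℝ) ^ 4) / (stepScale 3 Lc j * (Lc : ℝ) ^ 4 * wVH 3 Lc (j + 1))) =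
      (-((Lc : ℝ) ^ 8 / 2)) * wVH 3 Lc (j + 1) / (stepScale 3 Lc (j + 1) * (Lc : ℝ) ^ 4) :=
  locks_of_pin (Lc := Lc) ((Lc : ℝ) ^ 4) (-((Lc : ℝ) ^ 8 / 2)) (pin_of_bcj (Lc := Lc) _ rfl) j

/-- NOT IN PRINT; OUR BOOKKEEPING.  **THE (Sr-conj) LAW OF `SpureRecAt j` AT THE PIN, EVERY LEVEL** (an2 gen 17's `pureZero_bref ∕ pureSucc_bref`, locks discharged):
`S_j κ (bref α κ u) = ε_κ^α • refK (Φ Lc α) (S_j κ u + conjV 𝕄_j (γ_j • diagK (ctGen 3 α Lc κ u)))`, `γ_j = (−Lc⁸∕2)·wVH j ∕ (stepScale j·Lc⁴)`. -/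
theorem SpureRecAt_bref_pin (hLc : Odd Lc) (cΛ : ℝ) :
    ∀ (j : ℕ) (α κ : Fin 4) (u : Fin 4 → ℤ),
      SpureRecAt 3 Lc (toSite (ctrOff 4 Lc)) ((Lc : ℝ) ^ 4) (-((Lc : ℝ) ^ 8 / 2)) cΛ j κ (bref α κ u) =
        reflSign α κ • refK (Φ Lc α)
          (SpureRecAt 3 Lc (toSite (ctrOff 4 Lc)) ((Lc : ℝ) ^ 4) (-((Lc : ℝ) ^ 8 / 2)) cΛ j κ u +
            conjV (bhKStepAt 3 (toSite (ctrOff 4 Lc)) Lc j)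
              (((-((Lc : ℝ) ^ 8 / 2)) * wVH 3 Lc j / (stepScale 3 Lc j * (Lc : ℝ) ^ 4)) • diagK (ctGen 3 α Lc κ u))) := by
  intro j
  cases j with
  | zero =>
    intro α κ u
    have h := pureZero_bref hLc ((Lc : ℝ) ^ 4) (-((Lc : ℝ) ^ 8 / 2)) cΛ two_mul_cVH_pin
      (fun j => (-((Lc : ℝ) ^ 8 / 2)) * wVH 3 Lc j / (stepScale 3 Lc j * (Lc : ℝ) ^ 4)) (fun _ => rfl) (fun j => locks_pin j) α κ u
    simpa only [SpureRecAt_zero_level] using h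
  | succ j =>
    intro α κ u
    have h := pureSucc_bref hLc ((Lc : ℝ) ^ 4) (-((Lc : ℝ) ^ 8 / 2)) cΛ two_mul_cVH_pin
      (fun j => (-((Lc : ℝ) ^ 8 / 2)) * wVH 3 Lc j / (stepScale 3 Lc j * (Lc : ℝ) ^ 4)) (fun _ => rfl) (fun j => locks_pin j) j α κ u
    simpa only [SpureRecAt_succ] using h

end Law

/-! ## §3 The cubic cell charge vanishes -/

section Charge

variable {Lc : ℕ} [NeZero Lc]

omit [NeZero Lc] in
/-- [folklore] The scaled product-chart generator's FIELD leg is a single-site single-component delta: `(γ·ctGen α κ′ u) x (inl β) =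
[x = u ∧ β = κ′]·(−γ·[κ′ = α])`. -/
theorem mul_ctGen_inl (γ : ℝ) (α κ' : Fin 4) (u x : Fin 4 → ℤ) (β : Fin 4) :
    γ * ctGen 3 α Lc κ' u x (Sum.inl β) = if x = u ∧ β = κ' then (if κ' = α then -γ else 0) else 0 := by
  rw [ctGen_inl]
  by_cases h1 : x = u ∧ β = κ'
  · by_cases h2 : κ' = α
    · rw [if_pos ⟨h1.1, h1.2, h2⟩, if_pos h1, if_pos h2, mul_neg, mul_one]
    · rw [if_neg (fun h => h2 h.2.2), if_pos h1, if_neg h2, mul_zero]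
  · rw [if_neg (fun h => h1 ⟨h.1, h.2.1⟩), if_neg h1, mul_zero]

/-- NOT IN PRINT; OUR BOOKKEEPING.  **THE CUBIC CELL CHARGE OF THE COMB TOWER's PURE FIELD TABLE VANISHES** — every level `j`, every three-index pattern
`(κ′; κ₁, κ₂)`, at the pin, ANY `cΛ`; hypotheses `Odd Lc` only. -/
theorem cubicCellCharge_SpureRecAt_eq_zero (hLc : Odd Lc) (cΛ : ℝ) (j : ℕ) (κ' κ₁ κ₂ : Fin 4) :
    ∑ r ∈ box 4 Lc, ∑' x, ∑' z,
      SpureRecAt 3 Lc (toSite (ctrOff 4 Lc)) ((Lc : ℝ) ^ 4) (-((Lc : ℝ) ^ 8 / 2)) cΛ j κ' (toSite r) x z (Sum.inl κ₁) (Sum.inl κ₂) = 0 := by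
  have hL1 : 1 ≤ Lc := hLc.pos
  have hr := ctrOff_mem_box (d := 4) hL1
  obtain ⟨Cs, δ, hδ, hS⟩ := locStencil_SpureRecAt (d := 3) (Lc := Lc) hL1 hr ((Lc : ℝ) ^ 4) (-((Lc : ℝ) ^ 8 / 2)) cΛ j
  set γ : ℝ := (-((Lc : ℝ) ^ 8 / 2)) * wVH 3 Lc j / (stepScale 3 Lc j * (Lc : ℝ) ^ 4) with hγ
  refine cubicCharge_eq_zero_of_refl_conjV (N := Lc) (d := 3)
    (S := SpureRecAt 3 Lc (toSite (ctrOff 4 Lc)) ((Lc : ℝ) ^ 4) (-((Lc : ℝ) ^ 8 / 2)) cΛ j)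
    (𝕄 := fun _ => bhKStepAt 3 (toSite (ctrOff 4 Lc)) Lc j)
    (g := fun α κ' u p a => γ * ctGen 3 α Lc κ' u p a) (c := fun α κ' => if κ' = α then -γ else 0)
    (SpureRecAt_translate (d := 3) (toSite (ctrOff 4 Lc)) hL1 _ _ _ j) ?_ ?_
    (fun _ x a b => summable_bhKStepAt_row hr j x _ _) (fun _ z a b => summable_bhKStepAt_col hr j z _ _)
    (fun _ x a b => tsum_bhKStepAt_inl_inl_row_eq_zero _ j x a b) (fun _ z a b => tsum_bhKStepAt_inl_inl_col_eq_zero _ j z a b)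
    (fun κ' u x a b => summable_right_of_biLoc (hS κ' u) hδ _ _ x)
    (fun κ' u a b => (summable_prod_of_biLoc (hS κ' u) hδ (Sum.inl a) (Sum.inl b)).prod) κ' κ₁ κ₂
  · -- the law of §2, with the scalar moved inside the diagonal generator
    intro α κ' u
    rw [SpureRecAt_bref_pin hLc cΛ j α κ' u, smul_diagK]
  · -- the delta field leg
    intro α κ' u x β
    exact mul_ctGen_inl γ α κ' u x β

end Charge

end Summit.QuantumFields.BalabanUV.Beta.GAN24.CombCubicCellChargeZero

end
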